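import Mathlib
import HarnessLib
import HarnessLib.Audit
import Summits.NavierStokesRegularity.Statement
import Literature.Analysis.FluidPDE.ClassicalSolution
import Literature.Analysis.FluidPDE.LerayHopf
import Literature.Analysis.FluidPDE.SuitableWeak
import Literature.Analysis.FluidPDE.AxisymmetricEuler
import Literature.Analysis.FluidPDE.VectorCalculus
import Literature.Analysis.FluidPDE.NSWave0
import Summits.NavierStokesRegularity.NavierStokesRegularity.Theorems.AdiabaticEddyClayUniqueness
import HarnessLib.Audit.Status.Attr

/-!
Route: LandauTail

DORMANT since 2026-08-24T15:45:51Z (reconciler: no traction for 6.9 d (last activity item-evidence-added at 2026-08-17T18:15:25Z); parked, not closed — `ledger route dormant route-NavierStokesRegularity-LandauTail --off` to reactivate) — unstaffed, not closed; items shared with open routes are served there. `ledger route dormant <id> --off` reactivates.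

Route LandauTail — NavierStokesRegularity (Clay A), NEGATIVE side with a built-in positive dual;
realises idea card landau-tail-impulse-type-ii ("Landau jets as outer profile: Type-II blow-up by
impulse release of a collapsing swirling ring into an exact Landau far field, or a Liouville theorem
for the envelope |u| <= C/|x-x*|").

Thesis X (LandauTailBlowup), in words: for some viscosity nu > 0 there is a finite-energy
(Leray–Hopf) classical solution of unforced NS on R^3 x [0,T), T < infinity, from a rapidly decaying
smooth datum, which at some point x* develops a LANDAU TAIL at time T: at the parabolic scale the
solution converges to a nonzero steady (-1)-homogeneous profile U smooth on R^3 \ {0},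
   sqrt(T-t) u(t, x* + sqrt(T-t) y) -> U(y)  (t -> T-, every y != 0).
By Sverak's classification (Sverak2011; LemarieRieusset2016 p.318) such U are exactly the Landau
solutions (10.44), |U| ~ 1/|y|: the only explicit EXACT solutions of Leray's backward profile
equation (the scaling term aU + a y.grad U vanishes on (-1)-homogeneous fields), singular at y = 0
and hence outside Necas–Ruzicka–Sverak/Tsai (U not in L^3, grad U not in L^2_loc). The singularity
is automatically Type II in Seregin's scaled-energy sense in axisymmetry and super-self-similar at
the core ("two scales": inner core at eps(t) sqrt(T-t), eps -> 0).

Lean (elaborates, Sketch.lean rc 0; decl LandauTailBlowup):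
 ∃ ν > 0, ∃ T > 0, ∃ u p, IsClassicalNSSolutionOn (Ico 0 T) ν 0 u p ∧ IsLerayHopfOn T ν 0 (u 0) u ∧
HasRapidSpatialDecay (u 0) ∧ ∃ xs U P, [U,P smooth on {0}ᶜ ∧ (∀ x ≠ 0, convect U U x + gradient P x
= ν • Δ U x) ∧ (∀ x ≠ 0, div U x = 0) ∧ (∀ c > 0, ∀ x, U (c • x) = c⁻¹ • U x) ∧ U ≠ 0] ∧ ∀ y ≠ 0,
Tendsto (fun t => √(T-t) • u t (xs + √(T-t) • y)) (𝓝[<] T) (𝓝 (U y)).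

Assembly X → ¬NavierStokesRegularity: a Landau tail forces unboundedness near (x*,T), hence no
smooth extension past T (support TailForcesBlowup: X → X5a = Blowup.BlowupExists,
stmt-NavierStokesRegularity-0152 verbatim); with Clay-class uniqueness X5b (shared support
ClayUniqueness = stmt-NavierStokesRegularity-0153 verbatim) the PROVED glue
Literature.NS.blowup_assembly gives ¬A. Assembly item: X → X5b → ¬NavierStokesRegularity (verified
in Sketch.lean: `exact blowup_assembly ⟨hglue hX, h5b⟩`).

Two-layer plan (D-0019). Layer 1 (ranked): #2 LandauTailLocal — a local-energy-class first
singularity with a Landau tail exists at all (the singularity MODEL; nu = 1, at (0,0)); #3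
EnvelopeRegularity — the card's POSITIVE dual: a suitable weak solution in Q((0,0),1), smooth before
t = 0, with the spatial Type-I envelope |x| |u(t,x)| <= C (ANY C) is bounded near the origin
(non-axisymmetric KNSS Thm 5.3; kills every ENVELOPED Landau-tailed core and every Type-I DSS
profile with local energy bounds); #4 LandauTailTransfer — local model ⇒ Clay-data model
(truncation/stability of the collapse; the localisation question for NS singularities); #5
NoAxisymLandauTail — no axisymmetric Landau tail from Clay data (the Hou-tornado reading;
Seregin2020 Thm 2.1 forces all scaled energies to diverge at an axisymmetric singular point while
the Landau outer region contributes O(1)). Layer 2 (glue, later, by glued splits once a crux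
closes): LandauTailLocal ⇐ inner momentum pump (modulation law for eps(s) from the momentum-flux
condition d/dt ∫_{B_r} u = −b(U)) ∧ linearised spectral count around U in Gaussian-weighted
similarity variables ∧ nonlinear matching; LandauTailTransfer ⇐ weighted exterior stability of the
collapse.

Rationale: WHY THIS LINE. Every blow-up construction for NS must name an outer profile that survives the
Leray-profile Liouville theorems; the only explicit candidates NS possesses are Landau's jets
(Landau 1944; TianXin family; LemarieRieusset2016 Thm 10.13/(10.44); Sverak2011: the unique
(-1)-homogeneous steady flows smooth off the origin), which solve Leray's backward profile equation
for EVERY rate because the scaling term vanishes on degree -1 fields, and which evade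
NecasRuzickaSverak1996/Tsai1998 by being singular at 0. Imported from supercritical parabolic
blow-up theory (HerreroVelazquez1994; MerleEtAl2022 implosion onto singular self-similar outer
profiles): the two-scale matched architecture "smooth inner core at eps(t) sqrt(T-t) + exact
singular outer profile". NS adds one rigid constraint absent in Fujita (the card's 3-line flux
argument, confirmed by the novelty audit): a forceless core feeding a Landau far field must emit
momentum at the constant rate b(U) = Landau's point force (KarchZheng2015 keep that force; here it
must be an unsteady impulse pump, e.g. a collapsing swirling ring; swirl is forced by
Ukhovskii–Yudovich/KNSS, and the audit notes an isolated ring does not self-collapse, so the pump is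
NOT claimed, only the far-field architecture). Perturbation theory around Landau exists
(KarchPilarczyk2011, LiZhangZhang2022, JiaSverak2026Landau, Miura–Tsai arXiv:0810.2004). The route
is deliberately TWO-SIDED inside one file: the positive dual EnvelopeRegularity (rank 3) is the
statement that kills the enveloped sub-architecture AND every Type-I DSS profile with local energy
bounds (route Blowup crux BlowupTypeIDssProfile), and NoAxisymLandauTail (rank 5) is the
axisymmetric exclusion that the in-tree axisymmetric machinery (Seregin2020 Thm 2.1, LeiZhang2017,
knss_bound_C_over_r, SereginSverak2009) can attack now. Either outcome is informative; the audit's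
opinion "POS is the better investment" is reflected in the ranks 3/5 being typed, local and
prover-ready.
RANKED CRUXES. #2 LandauTailLocal (model exists; hardest, most informative: its refutation is a
Liouville theorem for asymptotically homogeneous first singularities, extending
tsai_selfsimilar_local_energy from exact to asymptotic self-similarity off the origin). #3
EnvelopeRegularity (spatial Type-I envelope, any C ⇒ regular; known for the space–time envelope |u|
≤ ε/(|x|+√(T−t)) with ε small by epsilon-regularity, and for axisymmetric u by KNSS Thm 5.3 /
Seregin2020 Thm 2.1 (the envelope bounds A(r) ≤ 4πC² on every sub-ball); open in general, even for
small C in the purely spatial form). #4 LandauTailTransfer (local ⇒ Clay data; Tao2011 Thm 20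
localises only between whole-space data classes / modulo forcing). #5 NoAxisymLandauTail
(sub-conjecture of AxisymmetricSwirlRegularity with a swirl-free far field as extra structure).
SUPPORT. TailForcesBlowup (X → BlowupExists, 15 lines: a smooth extension makes sqrt(T-t) u → 0 ≠
U(y)); ClayUniqueness (= stmt-0153, shared with Blowup/CertifiedBlowup; reduced there to
tao_unconditional_uniqueness_velocity); HomSteadyProfileExists (the Landau formula (10.44) satisfies
the typed profile class: sanity that the class is non-vacuous, pure calculus).
KILL CRITERIA. (i) LandauTailLocal refuted (a local Liouville theorem for Landau tails) closes the
route refuted and is a positive theorem of independent value; (ii) EnvelopeRegularity proved + a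
proof that any Landau-tailed core must be enveloped kills #2; (iii) NoBlowup (stmt-0054) proved
kills everything negative here; (iv) EnvelopeRegularity refuted, i.e. an ENVELOPED singular suitable
solution exhibited — that witness is itself Type-I-scenario news (cf. TypeIDSSLiouvilleConjecture)
and #2 is re-based on it.
NOT DECOMPOSED (deliberately). The inner pump (ring/tornado cartoon, modulation law eps(s)), the
spectral problem around U in similarity variables, the gluing; which symmetry class the core lives
in (the audit + KNSS 5.3 + Seregin2020 say: swirling and non-enveloped if axisymmetric, else
non-axisymmetric); numerics (sibling route CertifiedBlowup owns certificates). Definition request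
filed: Literature.Analysis.FluidPDE.landauSolution (explicit family + Sverak classification + flux
identity) — items are typed over the abstract profile class meanwhile, so nothing waits on it.
PRIOR-PROGRAMME NOTES: not read (plancard mode; card + literature + tree only).

Novelty: NOVELTY (searched 2026-08-15 for this route open; card already graded new-combination by
refuter-novelty-audit 2026-08-15): `lit search --source zbmath "Landau solution Navier-Stokes"` (24
rows: Sverak2011 = doi:10.1007/s10958-011-0590-5 = arXiv:math/0604550 classification; KarchZheng2015
arXiv:1401.3679 Landau-cored time-dependent singularities WITH a singular force; LiZhangZhang2022
arXiv:2012.14211 and KarchPilarczyk2011 stability of Landau solutions; Miura–Tsai arXiv:0810.2004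
point singularities; JiaSverak2026Landau arXiv:2605.24200 refined steady asymptotics), `lit search
--source zbmath "Sverak Landau solutions"` (+ Korolev–Sverak arXiv:0711.0560 large-distance
asymptotics, Tartaglione 2024 isolated singularities of STEADY NS), `lit galaxy search "homogeneous
solutions of stationary Navier-Stokes" --star pdf` (Li–Li–Yan arXiv:2410.11170 removable singularity
of (-1)-homogeneous steady solutions; their ARMA/DCDS series arXiv:1609.08197, 1901.08218 on
axis-singular homogeneous families), `lit search --source zbmath "Herrero Velázquez supercritical
blow up"` (HerreroVelazquez1994; Collot arXiv:1407.4525; Mukai–Seki 2021), `lit search --source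
zbmath "implosion compressible fluid Merle Raphaël Rodnianski Szeftel"` (MerleEtAl2022,
arXiv:1912.11009), `lit search --source zbmath "Seregin axisymmetric type I"` / "local regularity
axisymmetric" (Seregin2020 arXiv:2006.04140 Thm 2.1, read; Seregin JMFM 2022 arXiv:2109.09344,
arXiv:2201.00153), `lit search --hybrid "Landau soluti  [refs: 10.1007/s10958-011-0590-5, math/0604550, 1401.3679, 2012.14211, 0810.2004, 2605.24200, 0711.0560, 2410.11170, 1609.08197, 1407.4525, 1912.11009, 2006.04140, 2109.09344, 2201.00153, 2602.17570, doi:10.1007/s10958-011-0590-5, Sverak2011, KarchZheng2015, LiZhangZhang2022, KarchPilarczyk2011, HerreroVelazquez1994, MerleEtAl2022, Seregin2020, LemarieRieusset2016, KNSS2009, SereginSverak2009, AlbrittonB]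

Barriers (technique_class: blowup-construction matched-asymptotics landau-profile): BARRIERS (catalogue Literature/Barriers/NavierStokesRegularity read: 18 files; technique_class:
blowup-construction matched-asymptotics landau-profile).
- Literature.Barriers.NavierStokesRegularity.LeraySelfSimilarBlowupExclusion: met head-on and evaded
by HYPOTHESIS FAILURE, not approximation: the outer profile U is (-1)-homogeneous, so U is not in
L^3 (necas_ruzicka_sverak void), not in L^q for any q (tsai_selfsimilar void), grad U is not L^2_loc
near 0 and U is not C^2 on R^3 (not an IsLerayProfile at all); the blow-up is NOT exactly
self-similar (inner scale eps(t) sqrt(T-t), eps -> 0), so tsai_selfsimilar_local_energy (exact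
ansatz + local energy) does not apply either — LandauTailLocal even demands exactly Tsai's local
energy bounds, consistent only because convergence to U is on compacts of R^3 \ {0} (Chae2007-type
asymptotic-self-similarity exclusions need L^p convergence including the origin: the barrier's
evasions_known). Residual risk recorded as the why-might-fail of LandauTailLocal: an "asymptotic
Tsai Thm 2" may be provable.
- Literature.Barriers.NavierStokesRegularity.CriticalNormBlowupNecessity: respected, not evaded:
||u(t)||_3^3 >= int_{eps sqrt(T-t) < |x-x*| < r} |U|^3 ~ log(1/(eps^2 (T-t))) -> infinity, above the
triple-log floor (tao_L3_blowup_rate); no L^3-bounded ansatz is used.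
- Literature.Barriers.NavierStokesRegularity.SingularSetDimensionBound: respected: a single
space-time point (x*,T); the off-axis case of NoAxisymLandauTail is an instance of th

Novelty grade: new-combination — ROUTE REVIEW (refuter 2026-08-15, unit Dw-aa978c70): KEEP OPEN, no crux blocked; details in REVIEW_Dw_LandauTail.md + W_LT.lean on the route. 9/9 decls rc0; Lean-verified: Local+Transfer ⊢ target verbatim; Assembly provable now from TailForcesBlowup via proved blowup_assembly; NoAxisym = ¬(axisym wi (refuter refuter-rreview-route-HodgeConjecture-Dw-aa978c70-0, 2026-08-15T13:47:33Z; prior: Sverak2011 = doi:10.1007/s10958-011-0590-5 / arXiv:math/0604550 (classification of (-1)-homogeneous steady flows = Landau), KarchZheng2015 arXiv:1401.3679 and KarchSchonbekSchonbek2020 doi:10.3934/dcds.2020008 p.2 (Landau-cored time-dependent, even finite-energy, flows — but WITH the point force κδ_γ(t)), MiuraTsai2012 doi:10.1007/s00021-010-0046-6 (point singularities of steady flows are Landau t)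

History (route lifecycle, newest last):
- 2026-08-16T04:12:31Z · AUTO-CRUX (backfill): LandauTailBlowup — hypotheses of the deciding theorem that nothing in the route derives are cruxes (operator:999:1085951)
- 2026-08-24T15:45:51Z · DORMANT — reconciler: no traction for 6.9 d (last activity item-evidence-added at 2026-08-17T18:15:25Z); parked, not closed — `ledger route dormant route-NavierStokesRegu (operator:999:1733910)

sub-problem: NavierStokesRegularity · status: dormant · opened planner-plancard-NavierStokesRegularity-Navie-cf076547-0 2026-08-15T10:59:51Z · rev 3 · ledger route-NavierStokesRegularity-LandauTail
GENERATED by the gate from the ledger (D-0016/17). Provers cite these decls: `theorem foo : Summit.NavierStokesRegularity.NavierStokesRegularity.Theses.LandauTail.<Decl> := …` in Summits/NavierStokesRegularity/NavierStokesRegularity/Theorems/<Name>.lean.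
-/

namespace Summit.NavierStokesRegularity.NavierStokesRegularity.Theses.LandauTail

open scoped BigOperators Topology Manifold Classical MeasureTheory ProbabilityTheory Matrix InnerProductSpace ComplexConjugate ContinuousMap
open Filter Set Function TopologicalSpace MeasureTheory

attribute [summit_statement] _root_.NavierStokesRegularity

open Literature.NS

/-- item stmt-NavierStokesRegularity-1944 · crux (kind.auto-crux: conjecture-grade) · rank 0 · open · by planner
why it might fail: NS may be globally regular (NoBlowup, stmt-0054); Landau tails may be excluded by an asymptotic form of Tsai's local-energy Liouville theorem; no forceless core pumping the flux b(U) is known (KarchZheng2015 need a singular force; isolated vortex rings translate rather than collapse).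
sources: Sverak2011, LemarieRieusset2016, Tsai1998, NecasRuzickaSverak1996, KarchZheng2015, HerreroVelazquez1994
[target] X (card landau-tail-impulse-type-ii, NEG side): for some nu > 0, T > 0 there is a classical
NS solution on R^3 x [0,T), Leray-Hopf from a rapidly decaying smooth datum, a point xs and a
NONZERO steady (-1)-homogeneous profile (U,P), smooth on R^3 minus 0, solving steady NS off the
origin (= a Landau solution by Sverak2011; explicit formula LemarieRieusset2016 (10.44), Thm 10.13),
such that sqrt(T-t) u(t, xs + sqrt(T-t) y) -> U(y) as t -> T- for every y != 0 (parabolic-scale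
Landau tail). U is an exact solution of Leray's backward profile system for every rate a (the
scaling term a(U + y.grad U) vanishes in degree -1) but singular at 0, so necas_ruzicka_sverak /
tsai_selfsimilar* do not apply; the architecture is two-scale (inner core at eps(t) sqrt(T-t), eps
-> 0: Type II at the core), and the core must emit momentum at the constant rate b(U) = Landau's
point force (flux argument of the card). Maximality is NOT a conjunct: it follows (support
TailForcesBlowup). X <= LandauTailLocal + LandauTailTransfer (layer 1); killed in its enveloped form
by EnvelopeRegularity and in its axisymmetric form by NoAxisymLandauTail. -/
@[route_item "route-NavierStokesRegularity-LandauTail", crux]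
def LandauTailBlowup : Prop :=
  ∃ ν : ℝ, 0 < ν ∧ ∃ T : ℝ, 0 < T ∧ ∃ (u : ℝ → EuclideanSpace ℝ (Fin 3) → EuclideanSpace ℝ (Fin 3)) (p : ℝ → EuclideanSpace ℝ (Fin 3) → ℝ), Literature.Analysis.FluidPDE.IsClassicalNSSolutionOn (Set.Ico 0 T) ν 0 u p ∧ Literature.Analysis.FluidPDE.IsLerayHopfOn T ν 0 (u 0) u ∧ Literature.Analysis.FluidPDE.HasRapidSpatialDecay (u 0) ∧ ∃ (xs : EuclideanSpace ℝ (Fin 3)) (U : EuclideanSpace ℝ (Fin 3) → EuclideanSpace ℝ (Fin 3)) (P : EuclideanSpace ℝ (Fin 3) → ℝ), (ContDiffOn ℝ (⊤ : ℕ∞) U {0}ᶜ ∧ ContDiffOn ℝ (⊤ : ℕ∞) P {0}ᶜ ∧ (∀ x : EuclideanSpace ℝ (Fin 3), x ≠ 0 → Literature.Analysis.FluidPDE.convect U U x + gradient P x = ν • Laplacian.laplacian U x) ∧ (∀ x : EuclideanSpace ℝ (Fin 3), x ≠ 0 → Literature.Analysis.FluidPDE.VectorCalculus.divergence U x = 0)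 ∧ (∀ c : ℝ, 0 < c → ∀ x : EuclideanSpace ℝ (Fin 3), U (c • x) = c⁻¹ • U x) ∧ (∃ x : EuclideanSpace ℝ (Fin 3), U x ≠ 0)) ∧ (∀ y : EuclideanSpace ℝ (Fin 3), y ≠ 0 → Filter.Tendsto (fun t : ℝ => Real.sqrt (T - t) • u t (xs + Real.sqrt (T - t) • y)) (nhdsWithin T (Set.Iio T)) (nhds (U y)))

/-- item stmt-NavierStokesRegularity-1946 · crux · rank 2 · open · by planner
why it might fail: No forceless mechanism pumping the constant momentum flux b(U) is known (isolated rings translate, do not collapse; KarchZheng2015 use a singular force); an asymptotic Tsai Thm 2 (Liouville for first singularities converging to a homogeneous profile off 0 under local energy bounds) may hold.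
sources: Sverak2011, Tsai1998, KarchZheng2015, HerreroVelazquez1994, MerleEtAl2022, Seregin2020
[crux] THE SINGULARITY MODEL (nu = 1, singular point (0,0), no data/decay constraint at infinity):
there is a classical NS solution (u,p) on R^3 x (-1,0) with Tsai/Albritton-Barker local energy
bounds near the origin (sup_t int_{B_1} |u|^2 < oo, int_{-1}^0 int_{B_1} |grad u|^2 < oo) and a
nonzero steady (-1)-homogeneous profile (U,P) smooth off 0 (= Landau, Sverak2011) with sqrt(-t) u(t,
sqrt(-t) y) -> U(y) (t -> 0-, y != 0). Hardest and most informative item: PROVING it needs the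
layer-2 programme (inner unsteady momentum pump with modulation law eps(s) fixed by the flux
condition d/dt int_{B_r} u = -b(U) + o(1); spectrum of the linearisation at U in Gaussian-weighted
similarity variables; matching — the Herrero-Velazquez / Merle-Raphael-Rodnianski-Szeftel template
with U in the role of the singular steady state); REFUTING it is a new positive theorem: a
Liouville/rigidity statement for first-time singularities asymptotically homogeneous off the blow-up
point under local energy bounds (Tsai1998 Thm 2 covers only the EXACT ansatz lerayBackward a T U
with U smooth). Energy bookkeeping is consistent: the Landau region has sup_t int_{B_1}|u|^2 = O(1)
and the dissipation is finite iff -/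
@[route_item "route-NavierStokesRegularity-LandauTail", crux]
def LandauTailLocal : Prop :=
  ∃ (u : ℝ → EuclideanSpace ℝ (Fin 3) → EuclideanSpace ℝ (Fin 3)) (p : ℝ → EuclideanSpace ℝ (Fin 3) → ℝ) (U : EuclideanSpace ℝ (Fin 3) → EuclideanSpace ℝ (Fin 3)) (P : EuclideanSpace ℝ (Fin 3) → ℝ), (ContDiffOn ℝ (⊤ : ℕ∞) U {0}ᶜ ∧ ContDiffOn ℝ (⊤ : ℕ∞) P {0}ᶜ ∧ (∀ x : EuclideanSpace ℝ (Fin 3), x ≠ 0 → Literature.Analysis.FluidPDE.convect U U x + gradient P x = (1 : ℝ) • Laplacian.laplacian U x) ∧ (∀ x : EuclideanSpace ℝ (Fin 3), x ≠ 0 → Literature.Analysis.FluidPDE.VectorCalculus.divergence U x = 0) ∧ (∀ c : ℝ, 0 < c → ∀ x : EuclideanSpace ℝ (Fin 3), U (c • x) = c⁻¹ • U x) ∧ (∃ x : EuclideanSpace ℝ (Fin 3), U x ≠ 0)) ∧ Literature.Analysis.FluidPDE.IsClassicalNSSolutionOn (Set.Ioo (-1) 0) 1 0 u p ∧ (∃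 C : NNReal, ∀ t ∈ Set.Ioo (-1 : ℝ) 0, ∫⁻ x in Metric.ball (0 : EuclideanSpace ℝ (Fin 3)) 1, ‖u t x‖ₑ ^ 2 ≤ C) ∧ (∫⁻ t in Set.Ioo (-1 : ℝ) 0, ∫⁻ x in Metric.ball (0 : EuclideanSpace ℝ (Fin 3)) 1, ENNReal.ofReal (Literature.Analysis.FluidPDE.frobeniusNormSq (fderiv ℝ (u t) x)) < ⊤) ∧ (∀ y : EuclideanSpace ℝ (Fin 3), y ≠ 0 → Filter.Tendsto (fun t : ℝ => Real.sqrt (0 - t) • u t (Real.sqrt (0 - t) • y)) (nhdsWithin 0 (Set.Iio 0)) (nhds (U y)))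

/-- item stmt-NavierStokesRegularity-1947 · crux · rank 3 · open · by planner
why it might fail: Open even as folklore: no maximum-principle quantity is known without axisymmetry (KNSS2009 p.3: Liouville open even for steady flows); a non-axisymmetric enveloped singularity, e.g. a backward DSS solution with |u| <= C/(|x|+sqrt(-t)) (Tsai2018 Conj. 8.8 open), would refute it.
sources: KochNadirashviliSereginSverak2009, SereginSverak2009, Seregin2020, AlbrittonBarker2019, CaffarelliKohnNirenberg1982, ChaeWolf2017RemovingDSS
[crux] POSITIVE DUAL (the card's Liouville side), normalised to nu = 1, the backward unit parabolic
ball Q((0,0),1) = (-1,0) x B_1: if (u,p) is a suitable weak solution in Q((0,0),1) in the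
Albritton-Barker class (IsSuitableWeakSolutionInBall: local energy inequality + esssup_t
int_{B_1}|u|^2, grad u in L^2, p in L^{3/2} on the whole ball), smooth in the open cylinder, and
obeys the spatial Type-I ENVELOPE |x| |u(t,x)| <= C for SOME finite C (no smallness, no symmetry),
then the origin is not a backward singular point (u is bounded in some Q((0,0),r)). General
(xs,T,r,nu) reduce to this by translation and the scalings u -> lambda u(lambda^2 t, lambda x), u ->
nu^{-1} u(t/nu, x). KNOWN: the space-time version |u| <= eps/(|x|+sqrt(-t)) with eps small (then
C(r) <~ eps^3 and epsilon-regularity, Lin1998/CKN1982, applies; for the purely spatial envelope even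
small C seems unrecorded); axisymmetric u about the x_3-axis (|x| >= r_axis, so |u| <= C/r_axis:
KNSS2009 Thm 5.3 = knss_bound_C_over_r with the Seregin-Sverak 2009 zoom, and Seregin2020 Thm 2.1
since the envelope bounds A(r) <= 4 pi C^2, i.e. Type I in Seregin's g-sense); OPEN in general — the
pointwise (strongest) form of 'Type I -/
@[route_item "route-NavierStokesRegularity-LandauTail", crux]
def EnvelopeRegularity : Prop :=
  ∀ (C : ℝ) (u : ℝ → EuclideanSpace ℝ (Fin 3) → EuclideanSpace ℝ (Fin 3)) (p : ℝ → EuclideanSpace ℝ (Fin 3) → ℝ), (Literature.Analysis.FluidPDE.IsSuitableWeakSolutionOn (Literature.Analysis.FluidPDE.parabolicCylinderOpens 1 ((0 : ℝ), (0 : EuclideanSpace ℝ (Fin 3)))) 1 0 u p ∧ (∃ K : NNReal, ∀ᵐ t ∂(MeasureTheory.volume.restrict (Set.Ioo (-1 : ℝ) 0)), ∫⁻ x in Metric.ball (0 : EuclideanSpace ℝ (Fin 3)) 1, ‖u t x‖ₑ ^ 2 ≤ K) ∧ (∃ G : ℝ → EuclideanSpace ℝ (Fin 3) → EuclideanSpace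 ℝ (Fin 3) →L[ℝ] EuclideanSpace ℝ (Fin 3), Literature.Analysis.FluidPDE.HasWeakSpatialGradientOn (Literature.Analysis.FluidPDE.parabolicCylinderOpens 1 ((0 : ℝ), (0 : EuclideanSpace ℝ (Fin 3)))) u G ∧ ∫⁻ w in Literature.Analysis.FluidPDE.parabolicCylinder 1 ((0 : ℝ), (0 : EuclideanSpace ℝ (Fin 3))), ENNReal.ofReal (Literature.Analysis.FluidPDE.frobeniusNormSq (G w.1 w.2)) < ⊤) ∧ MeasureTheory.MemLp (Function.uncurry p) (3 / 2) (MeasureTheory.volume.restrict (Literature.Analysis.FluidPDE.parabolicCylinder 1 ((0 : ℝ), (0 : EuclideanSpace ℝ (Fin 3)))))) → ContDiffOn ℝ (⊤ : ℕ∞) (Function.uncurry u) (Literature.Analysis.FluidPDE.parabolicCylinder 1 ((0 : ℝ), (0 : EuclideanSpace ℝ (Fin 3)))) → (∀ t ∈ Set.Ioo (-1 : ℝ) 0, ∀ x ∈ Metric.ball (0 : EuclideanSpace ℝ (Fin 3)) 1, ‖x‖ * ‖u t x‖ ≤ C) → ∃ r : ℝ, 0 < r ∧ MeasureTheory.eLpNorm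 (Function.uncurry u) ⊤ (MeasureTheory.volume.restrict (Literature.Analysis.FluidPDE.parabolicCylinder r ((0 : ℝ), (0 : EuclideanSpace ℝ (Fin 3))))) < ⊤

/-- item stmt-NavierStokesRegularity-1948 · crux · rank 4 · open · by planner
why it might fail: NS is non-local, no finite propagation speed: Tao2011 Thm 20 localises only across whole-space data classes or modulo forcing; the local model may need an infinite-energy far field (fed like a Landau jet at infinity); finite-codimension stability of the collapse under truncation is unknown.
sources: Tao2011, KarchPilarczyk2011, LiZhangZhang2022, JiaSverak2026Landau, MerleEtAl2022
[crux] LOCAL MODEL => CLAY MODEL: if a Landau-tailed first singularity exists in the local-energy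
class (LandauTailLocal verbatim as hypothesis) then one exists inside a finite-energy classical
solution from a rapidly decaying datum (LandauTailBlowup verbatim as conclusion). This is the
truncation/gluing half of every blow-up construction, isolated: expected via weighted EXTERIOR
stability of the collapse (perturbation theory around Landau exists for the steady/forward problem:
KarchPilarczyk2011, LiZhangZhang2022, JiaSverak2026Landau) or via a general localisation principle
'first-time singularities with local energy bounds can be reproduced from Schwartz data' — which is
NOT in print: Tao2011 Thm 20 localises the regularity problem only across whole-space data classes
(Schwartz / H^1 / finite energy) and in the inhomogeneous direction (forcing allowed), never from a
solution without decay at infinity. As a material implication it also closes if LandauTailLocal is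
refuted (then vacuous) — that outcome breaks the route anyway — or if LandauTailBlowup is proved
outright. -/
@[route_item "route-NavierStokesRegularity-LandauTail", crux]
def LandauTailTransfer : Prop :=
  (∃ (u : ℝ → EuclideanSpace ℝ (Fin 3) → EuclideanSpace ℝ (Fin 3)) (p : ℝ → EuclideanSpace ℝ (Fin 3) → ℝ) (U : EuclideanSpace ℝ (Fin 3) → EuclideanSpace ℝ (Fin 3)) (P : EuclideanSpace ℝ (Fin 3) → ℝ), (ContDiffOn ℝ (⊤ : ℕ∞) U {0}ᶜ ∧ ContDiffOn ℝ (⊤ : ℕ∞) P {0}ᶜ ∧ (∀ x : EuclideanSpace ℝ (Fin 3), x ≠ 0 → Literature.Analysis.FluidPDE.convect U U x + gradient P x = (1 : ℝ) • Laplacian.laplacian U x) ∧ (∀ x : EuclideanSpace ℝ (Fin 3), x ≠ 0 → Literature.Analysis.FluidPDE.VectorCalculus.divergence U x = 0) ∧ (∀ c : ℝ, 0 < c → ∀ x : EuclideanSpace ℝ (Fin 3), U (c • x) = c⁻¹ • U x) ∧ (∃ x : EuclideanSpace ℝ (Fin 3), U x ≠ 0)) ∧ Literature.Analysis.FluidPDE.IsClassicalNSSolutionOn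 (Set.Ioo (-1) 0) 1 0 u p ∧ (∃ C : NNReal, ∀ t ∈ Set.Ioo (-1 : ℝ) 0, ∫⁻ x in Metric.ball (0 : EuclideanSpace ℝ (Fin 3)) 1, ‖u t x‖ₑ ^ 2 ≤ C) ∧ (∫⁻ t in Set.Ioo (-1 : ℝ) 0, ∫⁻ x in Metric.ball (0 : EuclideanSpace ℝ (Fin 3)) 1, ENNReal.ofReal (Literature.Analysis.FluidPDE.frobeniusNormSq (fderiv ℝ (u t) x)) < ⊤) ∧ (∀ y : EuclideanSpace ℝ (Fin 3), y ≠ 0 → Filter.Tendsto (fun t : ℝ => Real.sqrt (0 - t) • u t (Real.sqrt (0 - t) • y)) (nhdsWithin 0 (Set.Iio 0)) (nhds (U y)))) → (∃ ν : ℝ, 0 < ν ∧ ∃ T : ℝ, 0 < T ∧ ∃ (u : ℝ → EuclideanSpace ℝ (Fin 3) → EuclideanSpace ℝ (Fin 3)) (p : ℝ → EuclideanSpace ℝ (Fin 3) → ℝ), Literature.Analysis.FluidPDE.IsClassicalNSSolutionOn (Set.Ico 0 T) ν 0 u p ∧ Literature.Analysis.FluidPDE.IsLerayHopfOn T ν 0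 (u 0) u ∧ Literature.Analysis.FluidPDE.HasRapidSpatialDecay (u 0) ∧ ∃ (xs : EuclideanSpace ℝ (Fin 3)) (U : EuclideanSpace ℝ (Fin 3) → EuclideanSpace ℝ (Fin 3)) (P : EuclideanSpace ℝ (Fin 3) → ℝ), (ContDiffOn ℝ (⊤ : ℕ∞) U {0}ᶜ ∧ ContDiffOn ℝ (⊤ : ℕ∞) P {0}ᶜ ∧ (∀ x : EuclideanSpace ℝ (Fin 3), x ≠ 0 → Literature.Analysis.FluidPDE.convect U U x + gradient P x = ν • Laplacian.laplacian U x) ∧ (∀ x : EuclideanSpace ℝ (Fin 3), x ≠ 0 → Literature.Analysis.FluidPDE.VectorCalculus.divergence U x = 0) ∧ (∀ c : ℝ, 0 < c → ∀ x : EuclideanSpace ℝ (Fin 3), U (c • x) = c⁻¹ • U x) ∧ (∃ x : EuclideanSpace ℝ (Fin 3), U x ≠ 0)) ∧ (∀ y : EuclideanSpace ℝ (Fin 3), y ≠ 0 → Filter.Tendsto (fun t : ℝ => Real.sqrt (T - t) • u t (xs + Real.sqrt (T - t) • y)) (nhdsWithin T (Set.Iio T)) (nhds (U y))))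

/-- item stmt-NavierStokesRegularity-1949 · crux · rank 5 · open · by planner
why it might fail: Hou's axisymmetric interior tornado (arXiv:2107.06509; generalized-dimension sequel Hou2026) is numerically a swirling collapsing core with a jet-like far field; if it is a true singularity with Landau far field this item is false. Known tools control Gamma = r u_theta, not the poloidal core.
sources: Hou2022PotentiallySingularNS, Hou2026, Seregin2020, KochNadirashviliSereginSverak2009, SereginSverak2009, LeiZhang2017
[crux] AXISYMMETRIC EXCLUSION (the Hou-tornado reading of the card, typed as the statement provers
can attack now): no classical Leray-Hopf solution from a rapidly decaying datum that stays
axisymmetric (about the x_3-axis) on [0,T) develops a Landau tail at any point xs at time T. A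
sub-conjecture of the open AxisymmetricSwirlRegularity with strong extra structure: (i) the far
field is swirl-free Landau, so Gamma = r u_theta -> 0 at the parabolic scale |x - xs| ~ sqrt(T-t)
while Gamma obeys a drift-diffusion maximum principle (KNSS2009 Sec. 5); (ii) Seregin2020 Thm 2.1:
at an axisymmetric singular point ALL scaled energies A, C, E diverge, whereas the Landau region
contributes O(1) to each — so the core must carry kinetic energy >~ sqrt(T-t) at times T - t ~ r^2,
far above an enveloped core (energy ~ eps sqrt(T-t)); (iii) knss_bound_C_over_r: the core violates
|u| <= C/r; (iv) time rate is Type II (knss_no_axisymmetric_typeI, SereginSverak2009); (v)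
Gamma-criteria LeiZhang2017 (|Gamma| <~ |ln r|^{-2}) and Wei 2016 arXiv:1508.03318. Off-axis xs
would give a ring of singular points, excluded by CKN's P^1(S) = 0 for a suitable continuation —
provers may treat on-axis xs as the real c -/
@[route_item "route-NavierStokesRegularity-LandauTail", crux]
def NoAxisymLandauTail : Prop :=
  ∀ ν : ℝ, 0 < ν → ∀ T : ℝ, 0 < T → ∀ (u : ℝ → EuclideanSpace ℝ (Fin 3) → EuclideanSpace ℝ (Fin 3)) (p : ℝ → EuclideanSpace ℝ (Fin 3) → ℝ), Literature.Analysis.FluidPDE.IsClassicalNSSolutionOn (Set.Ico 0 T) ν 0 u p → Literature.Analysis.FluidPDE.IsLerayHopfOn T ν 0 (u 0) u → Literature.Analysis.FluidPDE.HasRapidSpatialDecay (u 0) → (∀ t ∈ Set.Ico 0 T, Literature.Analysis.FluidPDE.IsAxisymmetric (u t)) → ∀ (xs : EuclideanSpace ℝ (Fin 3)) (U : EuclideanSpace ℝ (Fin 3) → EuclideanSpace ℝ (Fin 3)) (P : EuclideanSpace ℝ (Fin 3) → ℝ), (ContDiffOn ℝ (⊤ : ℕ∞) U {0}ᶜ ∧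 ContDiffOn ℝ (⊤ : ℕ∞) P {0}ᶜ ∧ (∀ x : EuclideanSpace ℝ (Fin 3), x ≠ 0 → Literature.Analysis.FluidPDE.convect U U x + gradient P x = ν • Laplacian.laplacian U x) ∧ (∀ x : EuclideanSpace ℝ (Fin 3), x ≠ 0 → Literature.Analysis.FluidPDE.VectorCalculus.divergence U x = 0) ∧ (∀ c : ℝ, 0 < c → ∀ x : EuclideanSpace ℝ (Fin 3), U (c • x) = c⁻¹ • U x) ∧ (∃ x : EuclideanSpace ℝ (Fin 3), U x ≠ 0)) → ¬ (∀ y : EuclideanSpace ℝ (Fin 3), y ≠ 0 → Filter.Tendsto (fun t : ℝ => Real.sqrt (T - t) • u t (xs + Real.sqrt (T - t) • y)) (nhdsWithin T (Set.Iio T)) (nhds (U y)))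

/-- item stmt-NavierStokesRegularity-0153 · support · rank 8 · closed · proved by Summit.NavierStokesRegularity.NavierStokesRegularity.Theorems.adiabaticEddy_clayUniqueness_proof @ 47141fc88209 (prover) · by planner
sources: Tao2011, Fefferman2000, Prodi1959, Serrin1963
Fefferman's class (A) = jointly C^∞ on ℝ³×[0,∞) + sup_t ∫|u|² < ∞; no energy inequality, no decay of
∇u, no integrability in LPS scales is assumed. Claim: such (u,p) coincides on [0,T) with any
Leray–Hopf classical solution v from the same rapidly decaying datum. Expected route: smoothness +
bounded energy ⇒ u is a distributional solution with locally finite dissipation?? (NOT automatic: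
∫∫|∇u|² may be infinite) — this is exactly the delicate point; alternatives: Liouville-type control
of the pressure (p harmonic part must be affine ⇒ excluded by bounded energy), then local energy
inequality, then weak–strong uniqueness (Prodi 1959, Serrin 1963) against v which is in every LPS
class on compacts of [0,T). [sources: Prodi1959, Serrin1963, Fefferman2000, LemarieRieusset2002,
RobinsonRodrigoSadowski2016] -/
@[route_item "route-NavierStokesRegularity-LandauTail", crux]
def ClayUniqueness : Prop :=
  ∀ ν : ℝ, 0 < ν → ∀ (u₀ : EuclideanSpace ℝ (Fin 3) → EuclideanSpace ℝ (Fin 3)), Literature.Analysis.FluidPDE.HasRapidSpatialDecay u₀ → ∀ (u v : ℝ → EuclideanSpace ℝ (Fin 3) → EuclideanSpace ℝ (Fin 3)) (p q : ℝ → EuclideanSpace ℝ (Fin 3) → ℝ) (T : ℝ), 0 < T → Literature.Analysis.FluidPDE.IsSmoothOnHalfSpace u → Literature.Analysis.FluidPDE.IsSmoothOnHalfSpace p → Literature.Analysis.FluidPDE.IsNavierStokesSolution ν 0 u₀ u p → Literature.Analysis.FluidPDE.HasBoundedEnergy u → Literature.Analysis.FluidPDE.IsClassicalNSSolutionOn (Set.Ico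 0 T) ν 0 v q → Literature.Analysis.FluidPDE.IsLerayHopfOn T ν 0 u₀ v → v 0 = u₀ → ∀ t ∈ Set.Ico 0 T, u t = v t

/-- `ClayUniqueness` holds: proved by `Summit.NavierStokesRegularity.NavierStokesRegularity.Theorems.adiabaticEddy_clayUniqueness_proof` @ 47141fc88209. -/
theorem ClayUniqueness_holds : ClayUniqueness := _root_.Summit.NavierStokesRegularity.NavierStokesRegularity.Theorems.adiabaticEddy_clayUniqueness_proof

/-- item stmt-NavierStokesRegularity-1950 · support · rank 9 · closed · proved by Summit.NavierStokesRegularity.NavierStokesRegularity.Theorems.tailForcesBlowup_proof (prover) · by planner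
sources: BealeKatoMajda1984, Sverak2011
[support] Glue X -> X5a (Blowup.BlowupExists, stmt-NavierStokesRegularity-0152 verbatim): a Landau
tail at (xs,T) forbids a smooth extension past T. Proof (about 20 lines): from X take nu,T,u,p and
the tail data; IsMaximalSmoothSolution nu 0 u p T needs only ¬HasSmoothExtensionPast. If u' is
classical on Ico 0 T' (T' > T) with u' = u on Ico 0 T, then u' is jointly continuous at (T, xs)
(IsClassicalNSSolutionOn.smooth_velocity), so for y with U y != 0 (exists: homogeneity forces U 0 =
0, and U is nonzero somewhere) t -> u t (xs + sqrt(T-t) y) = u' t (...) tends to u' T xs along t ->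
T-, hence sqrt(T-t) • u t (...) -> 0; uniqueness of limits in R^3 (T2) against the hypothesis limit
U y != 0 is the contradiction. Uses: Real.sqrt continuity, tendsto of a jointly continuous function
along the curve t -> (t, xs + sqrt(T-t) y) within Ico 0 T'. -/
@[route_item "route-NavierStokesRegularity-LandauTail", crux]
def TailForcesBlowup : Prop :=
  (∃ ν : ℝ, 0 < ν ∧ ∃ T : ℝ, 0 < T ∧ ∃ (u : ℝ → EuclideanSpace ℝ (Fin 3) → EuclideanSpace ℝ (Fin 3)) (p : ℝ → EuclideanSpace ℝ (Fin 3) → ℝ), Literature.Analysis.FluidPDE.IsClassicalNSSolutionOn (Set.Ico 0 T) ν 0 u p ∧ Literature.Analysis.FluidPDE.IsLerayHopfOn T ν 0 (u 0) u ∧ Literature.Analysis.FluidPDE.HasRapidSpatialDecay (u 0) ∧ ∃ (xs : EuclideanSpace ℝ (Fin 3)) (U : EuclideanSpace ℝ (Fin 3) → EuclideanSpace ℝ (Fin 3)) (P : EuclideanSpace ℝ (Fin 3) → ℝ), (ContDiffOn ℝ (⊤ : ℕ∞) U {0}ᶜ ∧ ContDiffOn ℝ (⊤ : ℕ∞) P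 {0}ᶜ ∧ (∀ x : EuclideanSpace ℝ (Fin 3), x ≠ 0 → Literature.Analysis.FluidPDE.convect U U x + gradient P x = ν • Laplacian.laplacian U x) ∧ (∀ x : EuclideanSpace ℝ (Fin 3), x ≠ 0 → Literature.Analysis.FluidPDE.VectorCalculus.divergence U x = 0) ∧ (∀ c : ℝ, 0 < c → ∀ x : EuclideanSpace ℝ (Fin 3), U (c • x) = c⁻¹ • U x) ∧ (∃ x : EuclideanSpace ℝ (Fin 3), U x ≠ 0)) ∧ (∀ y : EuclideanSpace ℝ (Fin 3), y ≠ 0 → Filter.Tendsto (fun t : ℝ => Real.sqrt (T - t) • u t (xs + Real.sqrt (T - t) • y)) (nhdsWithin T (Set.Iio T)) (nhds (U y)))) → (∃ ν : ℝ, 0 < ν ∧ ∃ T : ℝ, 0 < T ∧ ∃ (u : ℝ → EuclideanSpace ℝ (Fin 3) → EuclideanSpace ℝ (Fin 3)) (p : ℝ → EuclideanSpace ℝ (Fin 3) → ℝ), Literature.Analysis.FluidPDE.IsMaximalSmoothSolution ν 0 u p T ∧ Literature.Analysis.FluidPDE.IsLerayHopfOn T ν 0 (u 0) u ∧ Literature.Analysis.FluidPDE.HasRapidSpatialDecay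 (u 0))

/-- item stmt-NavierStokesRegularity-1951 · support · rank 9 · closed · proved by Summit.NavierStokesRegularity.NavierStokesRegularity.Theorems.LandauTail.homSteadyProfileExists_proof @ df3faa7aaeed (prover) · by planner
sources: LemarieRieusset2016, Sverak2011
[support] SANITY / non-vacuity of the typed profile class (pure calculus, provable now): the Landau
solution with nu = 1 and any parameter A > 1, U_1 = 2 x_1 (A x_3 - |x|) / (|x| (A|x| - x_3)^2), U_2
= 2 x_2 (A x_3 - |x|) / (|x| (A|x| - x_3)^2), U_3 = 2 (A|x|^2 + A x_3^2 - 2 x_3 |x|) / (|x| (A|x| -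
x_3)^2), P = 4 (A x_3 - |x|) / (|x| (A|x| - x_3)^2) (LemarieRieusset2016 (10.44) with nu = 1; A|x| -
x_3 > 0 off the origin since A > 1) is smooth on R^3 minus 0, solves convect U U + grad P =
Laplacian U and div U = 0 there, is (-1)-homogeneous (U(c x) = c^{-1} U(x), c > 0; at x = 0 both
sides are the junk value forced to 0 by homogeneity — define U 0 := 0, P 0 := 0) and is nonzero.
Equivalent spherical form: u_r = (2/r)((A^2-1)/(A - cos th)^2 - 1), u_th = -2 sin th / (r (A - cos
th)), from the stream function psi = 2 r sin^2 th / (A - cos th). Any A > 1 will do (e.g. A = 2). -/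
@[route_item "route-NavierStokesRegularity-LandauTail", crux]
def HomSteadyProfileExists : Prop :=
  ∃ (U : EuclideanSpace ℝ (Fin 3) → EuclideanSpace ℝ (Fin 3)) (P : EuclideanSpace ℝ (Fin 3) → ℝ), (ContDiffOn ℝ (⊤ : ℕ∞) U {0}ᶜ ∧ ContDiffOn ℝ (⊤ : ℕ∞) P {0}ᶜ ∧ (∀ x : EuclideanSpace ℝ (Fin 3), x ≠ 0 → Literature.Analysis.FluidPDE.convect U U x + gradient P x = (1 : ℝ) • Laplacian.laplacian U x) ∧ (∀ x : EuclideanSpace ℝ (Fin 3), x ≠ 0 → Literature.Analysis.FluidPDE.VectorCalculus.divergence U x = 0) ∧ (∀ c : ℝ, 0 < c → ∀ x : EuclideanSpace ℝ (Fin 3), U (c • x) = c⁻¹ • U x) ∧ (∃ x : EuclideanSpace ℝ (Fin 3), U x ≠ 0))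

/-- item stmt-NavierStokesRegularity-1945 · assembly · rank 1 · closed · proved by Summit.NavierStokesRegularity.NavierStokesRegularity.Theorems.landauTail_assembly_proof (prover) · by planner
sources: Fefferman2000, Tao2011, BealeKatoMajda1984
[assembly] X -> X5b -> ¬NavierStokesRegularity. Glue: TailForcesBlowup turns X into X5a =
Blowup.BlowupExists (stmt-NavierStokesRegularity-0152 verbatim); the PROVED
Literature.NS.blowup_assembly (stmt-0151) applied to the pair (X5a, X5b) gives ¬A. Checked in the
planner's Sketch.lean (rc 0): `theorem assembly_of_glue (hglue : TailForcesBlowup) : Assembly := by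
intro hX h5b; exact Literature.NS.blowup_assembly ⟨hglue hX, h5b⟩`. Provable (about 5 lines) the
moment TailForcesBlowup is. X5b is the shared support ClayUniqueness = stmt-0153 (route Blowup
reduces it to the vendored Tao2011 Cor. 11.4 fact, stmt-0728). -/
@[route_item "route-NavierStokesRegularity-LandauTail", crux]
def Assembly : Prop :=
  (∃ ν : ℝ, 0 < ν ∧ ∃ T : ℝ, 0 < T ∧ ∃ (u : ℝ → EuclideanSpace ℝ (Fin 3) → EuclideanSpace ℝ (Fin 3)) (p : ℝ → EuclideanSpace ℝ (Fin 3) → ℝ), Literature.Analysis.FluidPDE.IsClassicalNSSolutionOn (Set.Ico 0 T) ν 0 u p ∧ Literature.Analysis.FluidPDE.IsLerayHopfOn T ν 0 (u 0) u ∧ Literature.Analysis.FluidPDE.HasRapidSpatialDecay (u 0) ∧ ∃ (xs : EuclideanSpace ℝ (Fin 3)) (U : EuclideanSpace ℝ (Fin 3) → EuclideanSpace ℝ (Fin 3)) (P : EuclideanSpace ℝ (Fin 3) → ℝ), (ContDiffOn ℝ (⊤ : ℕ∞) U {0}ᶜ ∧ ContDiffOn ℝ (⊤ : ℕ∞) P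 {0}ᶜ ∧ (∀ x : EuclideanSpace ℝ (Fin 3), x ≠ 0 → Literature.Analysis.FluidPDE.convect U U x + gradient P x = ν • Laplacian.laplacian U x) ∧ (∀ x : EuclideanSpace ℝ (Fin 3), x ≠ 0 → Literature.Analysis.FluidPDE.VectorCalculus.divergence U x = 0) ∧ (∀ c : ℝ, 0 < c → ∀ x : EuclideanSpace ℝ (Fin 3), U (c • x) = c⁻¹ • U x) ∧ (∃ x : EuclideanSpace ℝ (Fin 3), U x ≠ 0)) ∧ (∀ y : EuclideanSpace ℝ (Fin 3), y ≠ 0 → Filter.Tendsto (fun t : ℝ => Real.sqrt (T - t) • u t (xs + Real.sqrt (T - t) • y)) (nhdsWithin T (Set.Iio T)) (nhds (U y)))) → (∀ ν : ℝ, 0 < ν → ∀ (u₀ : EuclideanSpace ℝ (Fin 3) → EuclideanSpace ℝ (Fin 3)), Literature.Analysis.FluidPDE.HasRapidSpatialDecay u₀ → ∀ (u v : ℝ → EuclideanSpace ℝ (Fin 3) → EuclideanSpace ℝ (Fin 3)) (p q : ℝ → EuclideanSpace ℝ (Fin 3) → ℝ) (T : ℝ), 0 < T → Literature.Analysis.FluidPDE.IsSmoothOnHalfSpace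 u → Literature.Analysis.FluidPDE.IsSmoothOnHalfSpace p → Literature.Analysis.FluidPDE.IsNavierStokesSolution ν 0 u₀ u p → Literature.Analysis.FluidPDE.HasBoundedEnergy u → Literature.Analysis.FluidPDE.IsClassicalNSSolutionOn (Set.Ico 0 T) ν 0 v q → Literature.Analysis.FluidPDE.IsLerayHopfOn T ν 0 u₀ v → v 0 = u₀ → ∀ t ∈ Set.Ico 0 T, u t = v t) → ¬ NavierStokesRegularity

/-! D-0027 §2.1 — DECIDING THEOREM (planner-authored via `route open/edit --closes-file`; by planner-rbadge-NavierStokesRegularity-LandauTa-653a8d05-g2-0 2026-08-15T16:16:00Z):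
its hypotheses are this route's items and its conclusion the sub-problem Statement (glue_lint), and it elaborates with this file. -/

@[closes "route-NavierStokesRegularity-LandauTail"] theorem closes : LandauTailBlowup → LandauTailLocal → EnvelopeRegularity → LandauTailTransfer → NoAxisymLandauTail → ClayUniqueness → TailForcesBlowup → HomSteadyProfileExists → Assembly → ¬ _root_.NavierStokesRegularity :=
  fun h_LandauTailBlowup _h_LandauTailLocal _h_EnvelopeRegularity _h_LandauTailTransfer _h_NoAxisymLandauTail h_ClayUniqueness _h_TailForcesBlowup _h_HomSteadyProfileExists h_Assembly =>
    h_Assembly h_LandauTailBlowup h_ClayUniqueness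

end Summit.NavierStokesRegularity.NavierStokesRegularity.Theses.LandauTail
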